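import Mathlib
import HarnessLib
import HarnessLib.Audit
import Summits.Langlands.Statement
import Summits.Langlands.Langlands.Theses.PrimeSwitchSplit
import Summits.Langlands.Langlands.Theorems.FrobeniusAlgebraicityCarving
import Summits.Langlands.Langlands.Theses.FrobeniusUnitCarving

/-! # BC3 birth skeleton (pre-birth twin: verbatim copies of the crux and stub texts; `Iff.rfl` to the route decl once born) for
`FrobeniusUnitCarving.FrobeniusUnits` (FU, crux r2, DECIDING).  THREE-WAY SPLIT BY RANK one level down: n = 1 (`stub_rankOne`, ATTACKABLE: a de Rham
ℓ-adic character is the avatar of an algebraic Hecke character χ — tree fact `FramedGaloisRep.exists_heckeCharacter_of_isDeRhamFramed`, Serre 1968 III /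
Patrikis 2019 Prop. 2.2.1 — and the values χ(ϖ_v) are algebraic λ-UNITS for λ ∤ p_v since every λ-adic avatar χ_λ is a continuous character of a
compact group; PRINT, not yet in the tree) · n = 2 (`stub_rankTwo`: PRINT for odd ρ over totally real K with distinct HT weights — potential modularity
gives a compatible system, then the PROVED `compatibleFamilyRung` —, and for finite image; OPEN for even ρ / irregular weight / general K) · n ≥ 3
(`stub_higherRank`, the OPEN bulk: PRINT only on the potentially automorphic sector, BLGGT 2014 §5 — again through compatible systems).
`FrobeniusUnits_of` is the composition by cases (kernel-checked; sorries ONLY inside the three `stub_*`).  Also PROVED here: the crux restricts to each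
stub, and the two rungs `finiteOrderRung`, `compatibleFamilyRung`. -/

set_option linter.dupNamespace false
set_option linter.unusedVariables false
set_option linter.unreachableTactic false
set_option linter.unusedTactic false
set_option linter.unusedSimpArgs false
set_option linter.unusedSectionVars false

namespace Summit.Langlands.Langlands.Theses.FrobeniusUnitCarving.Birth.FrobeniusUnits

open Filter Polynomial
open scoped NumberField
open Summit.Langlands.Langlands.Theorems.FrobeniusAlgebraicityCarving (FrobeniusAlgebraicity ArithmeticWeakAutomorphy ArtinCase
  HasAlgebraicFrobenius isAlgebraic_symm exists_eq_charpoly_of_hasFrobCharpolyAt)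

/-- verbatim copy of the crux `FrobeniusUnits` (texts.json; = the route decl by `Iff.rfl` after birth). -/
def FrobeniusUnits : Prop :=
  ∀ (K : Type) [Field K] [NumberField K] (n : ℕ), 0 < n → ∀ (ℓ : ℕ) [Fact ℓ.Prime] (ι : PadicAlgCl ℓ ≃+* ℂ) (ρ : Literature.NumberTheory.GaloisRepresentations.FramedGaloisRep K (PadicAlgCl ℓ) n), ρ.toGaloisRep.IsIrreducible → ((∀ᶠ v : IsDedekindDomain.HeightOneSpectrum (NumberField.RingOfIntegers K) in cofinite, ρ.IsUnramifiedAt v) ∧ ∀ (v : IsDedekindDomain.HeightOneSpectrum (NumberField.RingOfIntegers K)) (hv : ((ℓ : ℕ) : NumberField.RingOfIntegers K) ∈ v.asIdeal), (Literature.NumberTheory.PAdicHodge.fontainePstAdicCompletion v ℓ hv).IsDeRhamFramed (ρ.toLocal v)) → ∀ᶠ v : IsDedekindDomain.HeightOneSpectrum (NumberField.RingOfIntegers K) in Filter.cofinite, ∀ P : Polynomial (PadicAlgCl ℓ), ρ.HasFrobCharpolyAt v P → ∀ β ∈ P.roots, ∀ (ℓ' : ℕ) [Fact ℓ'.Prime]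 (ι' : PadicAlgCl ℓ' ≃+* ℂ), ((ℓ' : ℕ) : NumberField.RingOfIntegers K) ∉ v.asIdeal → ‖ι'.symm (ι β)‖ = 1

/-- stub / rung text `RankOneFrobeniusUnits` (texts.json: the crux with ONE clause inserted). -/
def RankOneFrobeniusUnits : Prop :=
  ∀ (K : Type) [Field K] [NumberField K] (n : ℕ), 0 < n → n = 1 → ∀ (ℓ : ℕ) [Fact ℓ.Prime] (ι : PadicAlgCl ℓ ≃+* ℂ) (ρ : Literature.NumberTheory.GaloisRepresentations.FramedGaloisRep K (PadicAlgCl ℓ) n), ρ.toGaloisRep.IsIrreducible → ((∀ᶠ v : IsDedekindDomain.HeightOneSpectrum (NumberField.RingOfIntegers K) in cofinite, ρ.IsUnramifiedAt v) ∧ ∀ (v : IsDedekindDomain.HeightOneSpectrum (NumberField.RingOfIntegers K)) (hv : ((ℓ : ℕ) : NumberField.RingOfIntegers K) ∈ v.asIdeal), (Literature.NumberTheory.PAdicHodge.fontainePstAdicCompletion v ℓ hv).IsDeRhamFramed (ρ.toLocal v)) → ∀ᶠ v : IsDedekindDomain.HeightOneSpectrum (NumberField.RingOfIntegers K) in Filter.cofinite,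 ∀ P : Polynomial (PadicAlgCl ℓ), ρ.HasFrobCharpolyAt v P → ∀ β ∈ P.roots, ∀ (ℓ' : ℕ) [Fact ℓ'.Prime] (ι' : PadicAlgCl ℓ' ≃+* ℂ), ((ℓ' : ℕ) : NumberField.RingOfIntegers K) ∉ v.asIdeal → ‖ι'.symm (ι β)‖ = 1

/-- stub / rung text `RankTwoFrobeniusUnits` (texts.json: the crux with ONE clause inserted). -/
def RankTwoFrobeniusUnits : Prop :=
  ∀ (K : Type) [Field K] [NumberField K] (n : ℕ), 0 < n → n = 2 → ∀ (ℓ : ℕ) [Fact ℓ.Prime] (ι : PadicAlgCl ℓ ≃+* ℂ) (ρ : Literature.NumberTheory.GaloisRepresentations.FramedGaloisRep K (PadicAlgCl ℓ) n), ρ.toGaloisRep.IsIrreducible → ((∀ᶠ v : IsDedekindDomain.HeightOneSpectrum (NumberField.RingOfIntegers K) in cofinite, ρ.IsUnramifiedAt v) ∧ ∀ (v : IsDedekindDomain.HeightOneSpectrum (NumberField.RingOfIntegers K)) (hv : ((ℓ : ℕ) : NumberField.RingOfIntegers K) ∈ v.asIdeal), (Literature.NumberTheory.PAdicHodge.fontainePstAdicCompletion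 v ℓ hv).IsDeRhamFramed (ρ.toLocal v)) → ∀ᶠ v : IsDedekindDomain.HeightOneSpectrum (NumberField.RingOfIntegers K) in Filter.cofinite, ∀ P : Polynomial (PadicAlgCl ℓ), ρ.HasFrobCharpolyAt v P → ∀ β ∈ P.roots, ∀ (ℓ' : ℕ) [Fact ℓ'.Prime] (ι' : PadicAlgCl ℓ' ≃+* ℂ), ((ℓ' : ℕ) : NumberField.RingOfIntegers K) ∉ v.asIdeal → ‖ι'.symm (ι β)‖ = 1

/-- stub / rung text `HigherRankFrobeniusUnits` (texts.json: the crux with ONE clause inserted). -/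
def HigherRankFrobeniusUnits : Prop :=
  ∀ (K : Type) [Field K] [NumberField K] (n : ℕ), 0 < n → 3 ≤ n → ∀ (ℓ : ℕ) [Fact ℓ.Prime] (ι : PadicAlgCl ℓ ≃+* ℂ) (ρ : Literature.NumberTheory.GaloisRepresentations.FramedGaloisRep K (PadicAlgCl ℓ) n), ρ.toGaloisRep.IsIrreducible → ((∀ᶠ v : IsDedekindDomain.HeightOneSpectrum (NumberField.RingOfIntegers K) in cofinite, ρ.IsUnramifiedAt v) ∧ ∀ (v : IsDedekindDomain.HeightOneSpectrum (NumberField.RingOfIntegers K)) (hv : ((ℓ : ℕ) : NumberField.RingOfIntegers K) ∈ v.asIdeal), (Literature.NumberTheory.PAdicHodge.fontainePstAdicCompletion v ℓ hv).IsDeRhamFramed (ρ.toLocal v)) → ∀ᶠ v : IsDedekindDomain.HeightOneSpectrum (NumberField.RingOfIntegers K) in Filter.cofinite, ∀ P : Polynomial (PadicAlgCl ℓ), ρ.HasFrobCharpolyAt v P → ∀ β ∈ P.roots, ∀ (ℓ' : ℕ) [Fact ℓ'.Prime] (ι' : PadicAlgCl ℓ' ≃+* ℂ), ((ℓ' : ℕ)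 : NumberField.RingOfIntegers K) ∉ v.asIdeal → ‖ι'.symm (ι β)‖ = 1

/-- stub / rung text `FiniteOrderUnitRung` (texts.json: the crux with ONE clause inserted). -/
def FiniteOrderUnitRung : Prop :=
  ∀ (K : Type) [Field K] [NumberField K] (n : ℕ), 0 < n → ∀ (ℓ : ℕ) [Fact ℓ.Prime] (ι : PadicAlgCl ℓ ≃+* ℂ) (ρ : Literature.NumberTheory.GaloisRepresentations.FramedGaloisRep K (PadicAlgCl ℓ) n), ρ.toGaloisRep.IsIrreducible → (∃ k : ℕ, 0 < k ∧ ∀ σ : Field.absoluteGaloisGroup K, ρ σ ^ k = 1) → ((∀ᶠ v : IsDedekindDomain.HeightOneSpectrum (NumberField.RingOfIntegers K) in cofinite, ρ.IsUnramifiedAt v) ∧ ∀ (v : IsDedekindDomain.HeightOneSpectrum (NumberField.RingOfIntegers K)) (hv : ((ℓ : ℕ) : NumberField.RingOfIntegers K) ∈ v.asIdeal), (Literature.NumberTheory.PAdicHodge.fontainePstAdicCompletion v ℓ hv).IsDeRhamFramed (ρ.toLocal v)) → ∀ᶠ v : IsDedekindDomain.HeightOneSpectrum (NumberField.RingOfIntegers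 K) in Filter.cofinite, ∀ P : Polynomial (PadicAlgCl ℓ), ρ.HasFrobCharpolyAt v P → ∀ β ∈ P.roots, ∀ (ℓ' : ℕ) [Fact ℓ'.Prime] (ι' : PadicAlgCl ℓ' ≃+* ℂ), ((ℓ' : ℕ) : NumberField.RingOfIntegers K) ∉ v.asIdeal → ‖ι'.symm (ι β)‖ = 1

/-- stub / rung text `CompatibleFamilyUnitRung` (texts.json: the crux with ONE clause inserted). -/
def CompatibleFamilyUnitRung : Prop :=
  ∀ (K : Type) [Field K] [NumberField K] (n : ℕ), 0 < n → ∀ (ℓ : ℕ) [Fact ℓ.Prime] (ι : PadicAlgCl ℓ ≃+* ℂ) (ρ : Literature.NumberTheory.GaloisRepresentations.FramedGaloisRep K (PadicAlgCl ℓ) n), ρ.toGaloisRep.IsIrreducible → (∃ S : Set (IsDedekindDomain.HeightOneSpectrum (NumberField.RingOfIntegers K)), S.Finite ∧ ∀ (ℓ' : ℕ) [Fact ℓ'.Prime] (ι' : PadicAlgCl ℓ' ≃+* ℂ), ∃ ρ' : Literature.NumberTheory.GaloisRepresentations.FramedGaloisRep K (PadicAlgCl ℓ') n, ∀ v ∉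 S, ((ℓ' : ℕ) : NumberField.RingOfIntegers K) ∉ v.asIdeal → ∀ P : Polynomial (PadicAlgCl ℓ), ρ.HasFrobCharpolyAt v P → ∃ P' : Polynomial (PadicAlgCl ℓ'), ρ'.HasFrobCharpolyAt v P' ∧ P'.map (ι' : PadicAlgCl ℓ' →+* ℂ) = P.map (ι : PadicAlgCl ℓ →+* ℂ)) → ((∀ᶠ v : IsDedekindDomain.HeightOneSpectrum (NumberField.RingOfIntegers K) in cofinite, ρ.IsUnramifiedAt v) ∧ ∀ (v : IsDedekindDomain.HeightOneSpectrum (NumberField.RingOfIntegers K)) (hv : ((ℓ : ℕ) : NumberField.RingOfIntegers K) ∈ v.asIdeal), (Literature.NumberTheory.PAdicHodge.fontainePstAdicCompletion v ℓ hv).IsDeRhamFramed (ρ.toLocal v)) → ∀ᶠ v : IsDedekindDomain.HeightOneSpectrum (NumberField.RingOfIntegers K) in Filter.cofinite, ∀ P : Polynomial (PadicAlgCl ℓ), ρ.HasFrobCharpolyAt v P → ∀ β ∈ P.roots, ∀ (ℓ' : ℕ) [Fact ℓ'.Prime] (ι' : PadicAlgCl ℓ' ≃+* ℂ), ((ℓ'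 : ℕ) : NumberField.RingOfIntegers K) ∉ v.asIdeal → ‖ι'.symm (ι β)‖ = 1

section Dial

open IsDedekindDomain NumberField Literature.NumberTheory.GaloisRepresentations Literature.NumberTheory.Automorphic

variable (K : Type) [Field K] [NumberField K] (ℓ : ℕ) [Fact ℓ.Prime]

/-- `ρ` (seen through `ι`) HAS UNIT FROBENIUS AVATARS at almost every place (the FU conclusion, literally). [folklore] -/
def HasUnitFrobenius {n : ℕ} (ι : PadicAlgCl ℓ ≃+* ℂ) (ρ : FramedGaloisRep K (PadicAlgCl ℓ) n) : Prop :=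
  ∀ᶠ v : IsDedekindDomain.HeightOneSpectrum (NumberField.RingOfIntegers K) in Filter.cofinite, ∀ P : Polynomial (PadicAlgCl ℓ), ρ.HasFrobCharpolyAt v P → ∀ β ∈ P.roots, ∀ (ℓ' : ℕ) [Fact ℓ'.Prime] (ι' : PadicAlgCl ℓ' ≃+* ℂ), ((ℓ' : ℕ) : NumberField.RingOfIntegers K) ∉ v.asIdeal → ‖ι'.symm (ι β)‖ = 1

variable {K ℓ}

/-! ### Kernel helpers, I: eigenvalues of compact-image representations are UNITS -/

section CompactImage

open scoped Matrix MatrixGroups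

/-! Re-proofs (suffix `_fu`) of the `≤ 1` half from the tree's `Literature.NumberTheory.GaloisRepresentations.CompactImageCharpolyIntegral`
(`FramedRep.norm_le_one_of_isRoot_charpoly`, Serre 1968 Ch. I §1.1), which is not in this file's import closure (the 1066 proof file re-proves
it privately for the same reason); then the NEW `= 1` half by the determinant. -/

variable {A : Type*} [NormedField A] {m : Type*} [Fintype m] [DecidableEq m]

omit [DecidableEq m] in
/-- entrywise bound ⇒ sup-norm operator bound. [folklore] -/
theorem norm_mulVec_le_of_forall_norm_le_fu {N : Matrix m m A} {C : ℝ} (hC : 0 ≤ C)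
    (h : ∀ i j, ‖N i j‖ ≤ C) (w : m → A) :
    ‖N *ᵥ w‖ ≤ Fintype.card m * C * ‖w‖ := by
  refine (pi_norm_le_iff_of_nonneg (by positivity)).mpr fun i => ?_
  calc ‖(N *ᵥ w) i‖ = ‖∑ j, N i j * w j‖ := rfl
    _ ≤ ∑ j, ‖N i j * w j‖ := norm_sum_le _ _
    _ ≤ ∑ _j : m, C * ‖w‖ := Finset.sum_le_sum fun j _ => by
        rw [norm_mul]
        exact mul_le_mul (h i j) (norm_le_pi_norm w j) (norm_nonneg _) hC
    _ = Fintype.card m * C * ‖w‖ := by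
        rw [Finset.sum_const, Finset.card_univ, nsmul_eq_mul]
        ring

/-- powers act on an eigenvector by powers of the eigenvalue. [folklore] -/
theorem pow_mulVec_eq_pow_smul_fu {N : Matrix m m A} {μ : A} {v : m → A} (hv : N *ᵥ v = μ • v)
    (k : ℕ) : (N ^ k) *ᵥ v = μ ^ k • v := by
  induction k with
  | zero => simp
  | succ k ih =>
    rw [pow_succ, ← Matrix.mulVec_mulVec, hv, Matrix.mulVec_smul, ih, smul_smul, ← pow_succ']

/-- eigenvalues of a power-bounded matrix have norm `≤ 1`. [folklore] -/
theorem norm_le_one_of_isRoot_charpoly_of_pow_bounded_fu {N : Matrix m m A} {C : ℝ}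
    (hC : ∀ k : ℕ, ∀ i j, ‖(N ^ k) i j‖ ≤ C) {μ : A} (hμ : N.charpoly.IsRoot μ) : ‖μ‖ ≤ 1 := by
  have hev : Module.End.HasEigenvalue (Matrix.toLin' N) μ := by
    rw [Module.End.hasEigenvalue_iff_isRoot_charpoly, Matrix.charpoly_toLin']
    exact hμ
  obtain ⟨v, hv⟩ := hev.exists_hasEigenvector
  have hv0 : v ≠ 0 := hv.2
  have hNv : N *ᵥ v = μ • v := by
    have h := hv.apply_eq_smul
    rwa [Matrix.toLin'_apply] at h
  have hvpos : 0 < ‖v‖ := norm_pos_iff.mpr hv0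
  have hm : Nonempty m := by
    by_contra h
    rw [not_nonempty_iff] at h
    exact hv0 (Subsingleton.elim _ _)
  obtain ⟨i₀⟩ := hm
  have hC0 : 0 ≤ C := (norm_nonneg _).trans (hC 0 i₀ i₀)
  have hbound : ∀ k : ℕ, ‖μ‖ ^ k ≤ Fintype.card m * C := by
    intro k
    have h1 : ‖(N ^ k) *ᵥ v‖ ≤ Fintype.card m * C * ‖v‖ :=
      norm_mulVec_le_of_forall_norm_le_fu hC0 (hC k) v
    rw [pow_mulVec_eq_pow_smul_fu hNv, norm_smul, norm_pow] at h1
    exact le_of_mul_le_mul_right h1 hvpos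
  by_contra hlt
  rw [not_le] at hlt
  obtain ⟨k, hk⟩ := pow_unbounded_of_one_lt (Fintype.card m * C) hlt
  exact absurd (hbound k) (not_le.mpr hk)

/-- **an eigenvalue of a matrix of finite order is a root of unity**: `M ^ k = 1`, `β ∈ roots (charpoly M)` ⇒ `β ^ k = 1` (spectral mapping). [folklore] -/
theorem pow_eq_one_of_mem_roots_charpoly_of_pow_eq_one {K' : Type*} [Field K'] {d k : ℕ} {M : Matrix (Fin d) (Fin d) K'} (hM : M ^ k = 1)
    {β : K'} (hβ : β ∈ M.charpoly.roots) : β ^ k = 1 := by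
  classical
  rcases Nat.eq_zero_or_pos d with hd0 | hdpos
  · exfalso
    subst hd0
    have h1 : M.charpoly = 1 := by unfold Matrix.charpoly; exact Matrix.det_isEmpty
    rw [h1, Polynomial.roots_one] at hβ
    exact Multiset.notMem_zero _ hβ
  haveI : Nonempty (Fin d) := ⟨⟨0, hdpos⟩⟩
  have hroot : Polynomial.IsRoot M.charpoly β := Polynomial.isRoot_of_mem_roots hβ
  have hspec : β ∈ spectrum K' M := Matrix.mem_spectrum_of_isRoot_charpoly hroot
  have hspeck : β ^ k ∈ spectrum K' (M ^ k) := spectrum.pow_mem_pow M k hspec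
  rw [hM, ← map_one (algebraMap K' (Matrix (Fin d) (Fin d) K')), spectrum.scalar_eq, Set.mem_singleton_iff] at hspeck
  exact hspeck

variable {G : Type*} [Group G] [TopologicalSpace G] [CompactSpace G] {d : ℕ}

/-- matrix entries of a continuous representation of a COMPACT group are uniformly bounded. [folklore] -/
theorem FramedRep.exists_forall_norm_apply_le_fu (ρ : FramedRep G A d) :
    ∃ C : ℝ, ∀ (g : G) (i j : Fin d), ‖((ρ g : GL (Fin d) A) : Matrix (Fin d) (Fin d) A) i j‖ ≤ C := by
  set f : G → (Fin d → Fin d → A) :=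
    fun g i j => ((ρ g : GL (Fin d) A) : Matrix (Fin d) (Fin d) A) i j with hf_def
  have hf : Continuous f := by
    refine continuous_pi fun i => continuous_pi fun j => ?_
    exact (Units.continuous_val.comp (map_continuous ρ)).matrix_elem i j
  obtain ⟨C, hC⟩ := isCompact_univ.exists_bound_of_continuousOn hf.continuousOn
  refine ⟨C, fun g i j => ?_⟩
  exact ((norm_le_pi_norm (f g i) j).trans (norm_le_pi_norm (f g) i)).trans (hC g (Set.mem_univ g))

/-- every eigenvalue of `ρ(g)` has norm `≤ 1` (compact `G`). Serre 1968, Ch. I §1.1. [folklore] -/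
theorem FramedRep.norm_le_one_of_isRoot_charpoly_fu (ρ : FramedRep G A d) (g : G) {μ : A}
    (hμ : (FramedRep.charpoly ρ g).IsRoot μ) : ‖μ‖ ≤ 1 := by
  obtain ⟨C, hC⟩ := FramedRep.exists_forall_norm_apply_le_fu ρ
  refine norm_le_one_of_isRoot_charpoly_of_pow_bounded_fu
    (N := ((ρ g : GL (Fin d) A) : Matrix (Fin d) (Fin d) A)) (C := C) (fun k i j => ?_) hμ
  have h : ((ρ g : GL (Fin d) A) : Matrix (Fin d) (Fin d) A) ^ k =
      ((ρ (g ^ k) : GL (Fin d) A) : Matrix (Fin d) (Fin d) A) := by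
    rw [map_pow, Units.val_pow_eq_pow_val]
  rw [h]
  exact hC (g ^ k) i j

omit [Fintype m] [DecidableEq m] in
/-- a multiset of elements of norm `≤ 1` has a product of norm `≤ 1`. [folklore] -/
theorem norm_multiset_prod_le_one (s : Multiset A) (h : ∀ x ∈ s, ‖x‖ ≤ 1) : ‖s.prod‖ ≤ 1 := by
  induction s using Multiset.induction_on with
  | empty => simp
  | cons a s ih =>
    rw [Multiset.prod_cons, norm_mul]
    exact mul_le_one₀ (h a (Multiset.mem_cons_self a s)) (norm_nonneg _)
      (ih fun x hx => h x (Multiset.mem_cons_of_mem hx))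

variable [IsAlgClosed A]

/-- **the determinant of `ρ(g)` has norm exactly `1`** (compact `G`, algebraically closed coefficients): `‖det ρ(g)‖ ≤ 1` and `‖det ρ(g⁻¹)‖ ≤ 1`
(products of eigenvalues of norm `≤ 1`) with product `1`. [folklore] -/
theorem FramedRep.norm_det_eq_one (ρ : FramedRep G A d) (g : G) :
    ‖((ρ g : GL (Fin d) A) : Matrix (Fin d) (Fin d) A).det‖ = 1 := by
  have hle : ∀ h : G, ‖((ρ h : GL (Fin d) A) : Matrix (Fin d) (Fin d) A).det‖ ≤ 1 := fun h => by
    rw [Matrix.det_eq_prod_roots_charpoly]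
    exact norm_multiset_prod_le_one _ fun μ hμ =>
      FramedRep.norm_le_one_of_isRoot_charpoly_fu ρ h (Polynomial.isRoot_of_mem_roots hμ)
  have hmul : ((ρ g : GL (Fin d) A) : Matrix (Fin d) (Fin d) A).det *
      ((ρ g⁻¹ : GL (Fin d) A) : Matrix (Fin d) (Fin d) A).det = 1 := by
    rw [← Matrix.det_mul, ← Units.val_mul, ← map_mul, mul_inv_cancel, map_one, Units.val_one, Matrix.det_one]
  have h1 : ‖((ρ g : GL (Fin d) A) : Matrix (Fin d) (Fin d) A).det‖ *
      ‖((ρ g⁻¹ : GL (Fin d) A) : Matrix (Fin d) (Fin d) A).det‖ = 1 := by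
    rw [← norm_mul, hmul, norm_one]
  have ha := hle g
  have hb := hle g⁻¹
  nlinarith [norm_nonneg ((ρ g : GL (Fin d) A) : Matrix (Fin d) (Fin d) A).det,
    norm_nonneg ((ρ g⁻¹ : GL (Fin d) A) : Matrix (Fin d) (Fin d) A).det]

/-- **NEW LEMMA — every eigenvalue of `ρ(g)` is a UNIT (norm exactly `1`)** for a continuous representation of a compact group over an
algebraically closed normed field: all eigenvalues have norm `≤ 1` and their product, the determinant, has norm `1`.  (The tree's
`CompactImageCharpolyIntegral` has the `≤ 1` half only.) Serre 1968 Ch. I §1.1 / §2.3. [folklore] -/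
theorem FramedRep.norm_eq_one_of_isRoot_charpoly (ρ : FramedRep G A d) (g : G) {μ : A}
    (hμ : (FramedRep.charpoly ρ g).IsRoot μ) : ‖μ‖ = 1 := by
  have hle : ∀ x ∈ (FramedRep.charpoly ρ g).roots, ‖x‖ ≤ 1 := fun x hx =>
    FramedRep.norm_le_one_of_isRoot_charpoly_fu ρ g (Polynomial.isRoot_of_mem_roots hx)
  have hne : FramedRep.charpoly ρ g ≠ 0 := (Matrix.charpoly_monic _).ne_zero
  have hmem : μ ∈ (FramedRep.charpoly ρ g).roots := (Polynomial.mem_roots hne).2 hμ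
  obtain ⟨t, ht⟩ := Multiset.exists_cons_of_mem hmem
  have hdet : ‖((ρ g : GL (Fin d) A) : Matrix (Fin d) (Fin d) A).det‖ = ‖μ‖ * ‖t.prod‖ := by
    rw [Matrix.det_eq_prod_roots_charpoly]
    change ‖(FramedRep.charpoly ρ g).roots.prod‖ = _
    rw [ht, Multiset.prod_cons, norm_mul]
  have h1 : ‖μ‖ * ‖t.prod‖ = 1 := by rw [← hdet, FramedRep.norm_det_eq_one]
  have hμ1 : ‖μ‖ ≤ 1 := hle μ hmem
  have ht1 : ‖t.prod‖ ≤ 1 := norm_multiset_prod_le_one t fun x hx => hle x (ht ▸ Multiset.mem_cons_of_mem hx)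
  nlinarith [norm_nonneg μ, norm_nonneg t.prod]

end CompactImage

/-! ### Kernel helpers, II: the dial on special representations (rung engines) and the bridge to g32's algebraicity dial -/

/-- a norm-one element stays norm one under inversion inside the argument: `‖ι'⁻¹(b)‖ = 1 → ‖ι'⁻¹(b⁻¹)‖ = 1`. [folklore] -/
theorem norm_symm_inv_eq_one {ℓ' : ℕ} [Fact ℓ'.Prime] (ι' : PadicAlgCl ℓ' ≃+* ℂ) {b : ℂ} (h : ‖ι'.symm b‖ = 1) : ‖ι'.symm b⁻¹‖ = 1 := by
  rw [map_inv₀, norm_inv, h, inv_one]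

/-- **FU for FINITE-ORDER `ρ`, at EVERY place**: a Frobenius root is a `k`-th root of unity, hence so is each of its avatars, which
therefore has norm `1`. [folklore] -/
theorem hasUnitFrobenius_of_finiteOrder {n : ℕ} (ι : PadicAlgCl ℓ ≃+* ℂ) (ρ : FramedGaloisRep K (PadicAlgCl ℓ) n) {k : ℕ} (hk : 0 < k)
    (hρ : ∀ σ : Field.absoluteGaloisGroup K, ρ σ ^ k = 1) : HasUnitFrobenius K ℓ ι ρ := by
  refine Filter.Eventually.of_forall fun v P hP β hβ ℓ' _ ι' _ => ?_
  obtain ⟨σ, -, hPσ⟩ := exists_eq_charpoly_of_hasFrobCharpolyAt ρ hP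
  have hM : ((ρ σ : GL (Fin n) (PadicAlgCl ℓ)) : Matrix (Fin n) (Fin n) (PadicAlgCl ℓ)) ^ k = 1 := by
    rw [← Units.val_pow_eq_pow_val, hρ σ, Units.val_one]
  rw [hPσ] at hβ
  have hβk : β ^ k = 1 := pow_eq_one_of_mem_roots_charpoly_of_pow_eq_one hM hβ
  have hx : (ι'.symm (ι β)) ^ k = 1 := by rw [← map_pow, ← map_pow, hβk, map_one, map_one]
  have hn : ‖ι'.symm (ι β)‖ ^ k = 1 := by rw [← norm_pow, hx, norm_one]
  exact (pow_eq_one_iff_of_nonneg (norm_nonneg _) hk.ne').1 hn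

/-- **FU for MEMBERS OF FULL COMPATIBLE FAMILIES** («Frobenius eigenvalues in a compatible system are `p`-units»): at `v ∉ S` with `v ∤ ℓ'`,
`ι β` is a root of `ι'(P')` for a Frobenius polynomial `P'` of the `ℓ'`-adic companion `ρ'`, i.e. `ι'⁻¹(ι β)` is an eigenvalue of `ρ'` at a
Frobenius, a unit by `FramedRep.norm_eq_one_of_isRoot_charpoly` (compact Galois group). [folklore] -/
theorem hasUnitFrobenius_of_compatibleFamily {n : ℕ} (ι : PadicAlgCl ℓ ≃+* ℂ) (ρ : FramedGaloisRep K (PadicAlgCl ℓ) n)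
    {S : Set (HeightOneSpectrum (𝓞 K))} (hS : S.Finite)
    (hfam : ∀ (ℓ' : ℕ) [Fact ℓ'.Prime] (ι' : PadicAlgCl ℓ' ≃+* ℂ), ∃ ρ' : FramedGaloisRep K (PadicAlgCl ℓ') n, ∀ v ∉ S,
      ((ℓ' : ℕ) : 𝓞 K) ∉ v.asIdeal → ∀ P : Polynomial (PadicAlgCl ℓ), ρ.HasFrobCharpolyAt v P →
        ∃ P' : Polynomial (PadicAlgCl ℓ'), ρ'.HasFrobCharpolyAt v P' ∧ P'.map (ι' : PadicAlgCl ℓ' →+* ℂ) = P.map (ι : PadicAlgCl ℓ →+* ℂ)) :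
    HasUnitFrobenius K ℓ ι ρ := by
  filter_upwards [hS.compl_mem_cofinite] with v hvS P hP β hβ ℓ' _ ι' hvℓ'
  obtain ⟨ρ', hρ'⟩ := hfam ℓ' ι'
  obtain ⟨P', hP', heq⟩ := hρ' v hvS hvℓ' P hP
  obtain ⟨σ, -, hPσ⟩ := exists_eq_charpoly_of_hasFrobCharpolyAt ρ' hP'
  have hβroot : (P.map (ι : PadicAlgCl ℓ →+* ℂ)).IsRoot (ι β) := (Polynomial.isRoot_of_mem_roots hβ).map
  rw [← heq] at hβroot
  have hroot' : P'.IsRoot (ι'.symm (ι β)) := by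
    refine Polynomial.IsRoot.of_map (f := (ι' : PadicAlgCl ℓ' →+* ℂ)) ?_ (ι' : PadicAlgCl ℓ' →+* ℂ).injective
    have : (ι' : PadicAlgCl ℓ' →+* ℂ) (ι'.symm (ι β)) = ι β := ι'.apply_symm_apply (ι β)
    rw [this]
    exact hβroot
  rw [hPσ] at hroot'
  haveI : CompactSpace (Field.absoluteGaloisGroup K) := absoluteGaloisGroup_compactSpace K
  exact FramedRep.norm_eq_one_of_isRoot_charpoly ρ' σ hroot'

omit [NumberField K] in
/-- a prime of `𝓞 K` does not contain both `2` and `3`. [folklore] -/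
theorem two_not_mem_or_three_not_mem (v : HeightOneSpectrum (𝓞 K)) :
    ((2 : ℕ) : 𝓞 K) ∉ v.asIdeal ∨ ((3 : ℕ) : 𝓞 K) ∉ v.asIdeal := by
  by_contra h
  rw [not_or, not_not, not_not] at h
  have h1 : (1 : 𝓞 K) ∈ v.asIdeal := by
    have h' : ((3 : ℕ) : 𝓞 K) - ((2 : ℕ) : 𝓞 K) ∈ v.asIdeal := v.asIdeal.sub_mem h.2 h.1
    have e : ((3 : ℕ) : 𝓞 K) - ((2 : ℕ) : 𝓞 K) = 1 := by push_cast; norm_num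
    rwa [e] at h'
  exact v.isPrime.ne_top ((Ideal.eq_top_iff_one _).2 h1)

omit [NumberField K] in
/-- **THE UNIT DIAL REFINES THE ALGEBRAICITY DIAL (per representation)**: unit avatars at the single prime `ℓ' ∈ {2, 3}` not under `v`, for
ALL `ι'`, already force `ι β` — hence `β` — to be algebraic (Steinitz: a transcendental can be moved by `Aut ℂ` onto its quotient by `ℓ'`;
tree `LArithmeticOfAutToGal.isAlgebraic_of_forall_norm_symm_le_one`). [folklore] -/
theorem hasAlgebraicFrobenius_of_hasUnitFrobenius {n : ℕ} (ι : PadicAlgCl ℓ ≃+* ℂ) (ρ : FramedGaloisRep K (PadicAlgCl ℓ) n)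
    (h : HasUnitFrobenius K ℓ ι ρ) : HasAlgebraicFrobenius K ℓ ρ := by
  filter_upwards [h] with v hv P hP β hβ
  have key : ∀ (ℓ' : ℕ) [Fact ℓ'.Prime], ((ℓ' : ℕ) : 𝓞 K) ∉ v.asIdeal → IsAlgebraic ℚ β := fun ℓ' _ hℓ' => by
    have halg : IsAlgebraic ℚ (ι β) :=
      Summit.Langlands.Langlands.Theorems.LArithmeticOfAutToGal.isAlgebraic_of_forall_norm_symm_le_one ℓ'
        fun ι' => (hv P hP β hβ ℓ' ι' hℓ').le
    simpa using isAlgebraic_symm ι halg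
  rcases two_not_mem_or_three_not_mem v with h2 | h3
  · haveI : Fact (Nat.Prime 2) := ⟨Nat.prime_two⟩
    exact key 2 h2
  · haveI : Fact (Nat.Prime 3) := ⟨Nat.prime_three⟩
    exact key 3 h3

/-! ### Kernel helpers, III: local–global compatibility puts Satake parameters into Frobenius spectra (from the 1066 proof file) -/

section LocalGlobal

open scoped MatrixGroups Matrix Classical
open Field Summit.Langlands Summit.Langlands.Langlands.Theorems.ReciprocityUpToIrreducibility

variable {F : Type} [Field F] [NumberField F] {ℓ' : ℕ} [Fact ℓ'.Prime] {n : ℕ}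

/-- **rank `n ≥ 2`: local–global compatibility at `v ∤ ℓ'` makes `ι'⁻¹(a)` an EIGENVALUE of `ρ'` at the recipe Frobenius** — the body of the
tree's `LArithmeticOfAutToGal.norm_symm_le_one_of_localGlobalCompatibleAt` (1066 proof file) up to its last line, exposing the root. [folklore] -/
theorem exists_isRoot_charpoly_of_localGlobalCompatibleAt (hn : 1 < n) (R : ReciprocityData F)
    {hcpt : isCompact_glFiniteIntegralLevel n F} (ι' : PadicAlgCl ℓ' ≃+* ℂ)
    (π : CuspidalAutomorphicRepData n F hcpt) (ρ' : FramedGaloisRep F (PadicAlgCl ℓ') n)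
    {v : HeightOneSpectrum (𝓞 F)} (hv : ((ℓ' : ℕ) : 𝓞 F) ∉ v.asIdeal) {α : Multiset ℂ}
    (hα : π.1.HasSatakeParamAt v α) (hLG : LocalGlobalCompatibleAt R ι' π.1 ρ' v) {a : ℂ} (ha : a ∈ α) :
    ∃ g : absoluteGaloisGroup F, (FramedRep.charpoly ρ' g).IsRoot (ι'.symm a) := by
  obtain ⟨πv, rv, rℂ, hloc, hWD, -, hT, r', hr', hc⟩ := hLG
  obtain ⟨-, -, hchar'⟩ := LocalLanglandsDatum.recGL_unramified_of_hasSatakeParamAt hn hcpt π v α hα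
    (R.llc v) πv hloc r' hr'.isFrobSemisimple hc.symm
  obtain ⟨t, U, Φ, -, -, hΦ, -, -, hrec⟩ := hWD hv
  have hss : (rℂ.ρ Φ).charpoly = (α.map fun b => X - C b).prod := by
    obtain ⟨-, m, hm, hcm, hsum⟩ := hr'.2.2 Φ
    rw [hsum, LinearMap.charpoly_add_eq_of_isNilpotent_of_commute hm hcm, hchar' Φ hΦ]
  set g : absoluteGaloisGroup F :=
    absGaloisRestrict F (v.adicCompletion F) (WeilGroup.toAbsGalois (v.adicCompletion F) Φ) with hg
  have hmat : LinearMap.toMatrix' (rv.ρ Φ) =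
      ((ρ' g : GL (Fin n) (PadicAlgCl ℓ')) : Matrix (Fin n) (Fin n) (PadicAlgCl ℓ')) := by
    have h1 := hrec 1 1
    simp only [zpow_one, OneMemClass.coe_one, mul_one, map_one, toAdd_one, zero_smul, neg_zero,
      IsNilpotent.exp_zero] at h1
    rw [h1, FramedRep.toWeilGroupHom_apply, FramedGaloisRep.toLocal_apply]
  have hmapch : (FramedRep.charpoly ρ' g).map (ι' : PadicAlgCl ℓ' →+* ℂ) = (α.map fun b => X - C b).prod := by
    rw [← hss, charpoly_eq_charpoly_toMatrix', hT.1 Φ, hmat, Matrix.charpoly_map]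
    rfl
  refine ⟨g, ?_⟩
  refine Polynomial.IsRoot.of_map (f := (ι' : PadicAlgCl ℓ' →+* ℂ)) ?_ (ι' : PadicAlgCl ℓ' →+* ℂ).injective
  have hιa : (ι' : PadicAlgCl ℓ' →+* ℂ) (ι'.symm a) = a := ι'.apply_symm_apply a
  rw [hιa, hmapch, Polynomial.IsRoot.def, Polynomial.eval_multiset_prod, Multiset.prod_eq_zero_iff, Multiset.map_map]
  exact Multiset.mem_map.mpr ⟨a, ha, by simp⟩

/-- rank `n ≥ 2`: **`ι'⁻¹(a)` is an `ℓ'`-adic UNIT** for every Satake entry `a` at `v ∤ ℓ'` of a `π` locally–globally compatible with some `ρ'`. [folklore] -/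
theorem norm_symm_eq_one_of_localGlobalCompatibleAt (hn : 1 < n) (R : ReciprocityData F)
    {hcpt : isCompact_glFiniteIntegralLevel n F} (ι' : PadicAlgCl ℓ' ≃+* ℂ)
    (π : CuspidalAutomorphicRepData n F hcpt) (ρ' : FramedGaloisRep F (PadicAlgCl ℓ') n)
    {v : HeightOneSpectrum (𝓞 F)} (hv : ((ℓ' : ℕ) : 𝓞 F) ∉ v.asIdeal) {α : Multiset ℂ}
    (hα : π.1.HasSatakeParamAt v α) (hLG : LocalGlobalCompatibleAt R ι' π.1 ρ' v) {a : ℂ} (ha : a ∈ α) :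
    ‖ι'.symm a‖ = 1 := by
  obtain ⟨g, hg⟩ := exists_isRoot_charpoly_of_localGlobalCompatibleAt hn R ι' π ρ' hv hα hLG ha
  haveI : CompactSpace (absoluteGaloisGroup F) := absoluteGaloisGroup_compactSpace F
  exact FramedRep.norm_eq_one_of_isRoot_charpoly ρ' g hg

/-- rank `1` pattern: **a Satake–Frobenius compatible `ρ'` makes `ι'⁻¹(a⁻¹)` an `ℓ'`-adic UNIT** (an arithmetic Frobenius exists and its
characteristic polynomial is `∏ (X - ι'⁻¹(a⁻¹))`). [folklore] -/
theorem norm_symm_inv_eq_one_of_satakeFrobCompatibleAt {hcpt : isCompact_glFiniteIntegralLevel n F}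
    (ι' : PadicAlgCl ℓ' ≃+* ℂ) (π : AutomorphicRepData (AutomorphyDatum.gl n F hcpt))
    (ρ' : FramedGaloisRep F (PadicAlgCl ℓ') n) {v : HeightOneSpectrum (𝓞 F)} {α : Multiset ℂ}
    (hα : π.HasSatakeParamAt v α) (hsat : SatakeFrobCompatibleAt ι' π ρ' v) {a : ℂ} (ha : a ∈ α) :
    ‖ι'.symm a⁻¹‖ = 1 := by
  obtain ⟨α', hα', -, hcp⟩ := hsat
  obtain rfl : α = α' := AutomorphicRepData.hasSatakeParamAt_unique_holds π hα hα'
  obtain ⟨𝔓, h𝔓⟩ := IsDedekindDomain.HeightOneSpectrum.primesAbove_nonempty v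
  obtain ⟨σ, hσ⟩ := IsDedekindDomain.HeightOneSpectrum.exists_isArithFrobAt_of_mem_primesAbove_holds h𝔓
  have hch : FramedRep.charpoly ρ' σ = arithFrobPolyOfSatake ι' v.residueCard 1 α := hcp 𝔓 h𝔓 σ hσ
  haveI : CompactSpace (absoluteGaloisGroup F) := absoluteGaloisGroup_compactSpace F
  refine FramedRep.norm_eq_one_of_isRoot_charpoly ρ' σ ?_
  rw [hch]
  refine Polynomial.isRoot_of_mem_roots ?_
  rw [roots_arithFrobPolyOfSatake]
  exact Multiset.mem_map.mpr ⟨a, ha, by simp⟩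

/-- **both ranks: under direction (A) at `(F, n, ℓ')` for the avatar `ι'`, every Satake entry `a` at `v ∤ ℓ'` of an L-algebraic cuspidal `π`
satisfies `‖ι'⁻¹(a⁻¹)‖ = 1`.** [folklore] -/
theorem norm_symm_inv_eq_one_of_automorphicToGalois {R : ReciprocityData F} {hcpt : isCompact_glFiniteIntegralLevel n F}
    (hAG : AutomorphicToGalois n R hcpt) (ι' : PadicAlgCl ℓ' ≃+* ℂ) (π : CuspidalAutomorphicRepData n F hcpt) (hL : π.1.IsLAlgebraic)
    {v : HeightOneSpectrum (𝓞 F)} (hv : ((ℓ' : ℕ) : 𝓞 F) ∉ v.asIdeal) {α : Multiset ℂ} (hα : π.1.HasSatakeParamAt v α)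
    {a : ℂ} (ha : a ∈ α) : ‖ι'.symm a⁻¹‖ = 1 := by
  rcases Nat.lt_or_ge 1 n with hn | hn
  · obtain ⟨ρ', -, -, hcorr, -⟩ := hAG π hL ℓ' ι'
    exact norm_symm_inv_eq_one ι' (norm_symm_eq_one_of_localGlobalCompatibleAt hn R ι' π ρ' hv hα (hcorr.2 v) ha)
  · have hcard : Multiset.card α = n := hα.card_eq
    have hpos : 0 < Multiset.card α := Multiset.card_pos_iff_exists_mem.mpr ⟨a, ha⟩
    obtain rfl : n = 1 := le_antisymm hn (by omega)
    obtain ⟨ρ', -, hρ', -⟩ := stub_rankOne_corresponds_away_unramified F ℓ' hcpt R ι' π hL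
    exact norm_symm_inv_eq_one_of_satakeFrobCompatibleAt ι' π.1 ρ' hα (hρ' v hv ⟨α, hα⟩).1 ha

end LocalGlobal

end Dial

section Skeleton

open IsDedekindDomain NumberField Literature.NumberTheory.GaloisRepresentations

/-- STUB (M, ATTACKABLE; PRINT: Serre 1968 Ch. II–III + Weil 1956 — de Rham characters are avatars of algebraic Hecke characters whose uniformizer
values are algebraic `λ`-units away from `p_v`): FU at `n = 1`. -/
theorem stub_rankOne : ∀ (K : Type) [Field K] [NumberField K] (n : ℕ), 0 < n → n = 1 → ∀ (ℓ : ℕ) [Fact ℓ.Prime] (ι : PadicAlgCl ℓ ≃+* ℂ) (ρ : Literature.NumberTheory.GaloisRepresentations.FramedGaloisRep K (PadicAlgCl ℓ) n), ρ.toGaloisRep.IsIrreducible → ((∀ᶠ v : IsDedekindDomain.HeightOneSpectrum (NumberField.RingOfIntegers K) in cofinite, ρ.IsUnramifiedAt v) ∧ ∀ (v : IsDedekindDomain.HeightOneSpectrum (NumberField.RingOfIntegers K)) (hv : ((ℓ : ℕ) : NumberField.RingOfIntegers K) ∈ v.asIdeal), (Literature.NumberTheory.PAdicHodge.fontainePstAdicCompletion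 v ℓ hv).IsDeRhamFramed (ρ.toLocal v)) → ∀ᶠ v : IsDedekindDomain.HeightOneSpectrum (NumberField.RingOfIntegers K) in Filter.cofinite, ∀ P : Polynomial (PadicAlgCl ℓ), ρ.HasFrobCharpolyAt v P → ∀ β ∈ P.roots, ∀ (ℓ' : ℕ) [Fact ℓ'.Prime] (ι' : PadicAlgCl ℓ' ≃+* ℂ), ((ℓ' : ℕ) : NumberField.RingOfIntegers K) ∉ v.asIdeal → ‖ι'.symm (ι β)‖ = 1 := by
  sorry

/-- STUB (L; PRINT for odd regular ρ over totally real K and for finite image, OPEN for even / irregular / general K): FU at `n = 2`. -/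
theorem stub_rankTwo : ∀ (K : Type) [Field K] [NumberField K] (n : ℕ), 0 < n → n = 2 → ∀ (ℓ : ℕ) [Fact ℓ.Prime] (ι : PadicAlgCl ℓ ≃+* ℂ) (ρ : Literature.NumberTheory.GaloisRepresentations.FramedGaloisRep K (PadicAlgCl ℓ) n), ρ.toGaloisRep.IsIrreducible → ((∀ᶠ v : IsDedekindDomain.HeightOneSpectrum (NumberField.RingOfIntegers K) in cofinite, ρ.IsUnramifiedAt v) ∧ ∀ (v : IsDedekindDomain.HeightOneSpectrum (NumberField.RingOfIntegers K)) (hv : ((ℓ : ℕ) : NumberField.RingOfIntegers K) ∈ v.asIdeal), (Literature.NumberTheory.PAdicHodge.fontainePstAdicCompletion v ℓ hv).IsDeRhamFramed (ρ.toLocal v)) → ∀ᶠ v : IsDedekindDomain.HeightOneSpectrum (NumberField.RingOfIntegers K) in Filter.cofinite, ∀ P : Polynomial (PadicAlgCl ℓ), ρ.HasFrobCharpolyAt v P → ∀ β ∈ P.roots, ∀ (ℓ' : ℕ) [Fact ℓ'.Prime] (ι' : PadicAlgCl ℓ' ≃+* ℂ), ((ℓ' : ℕ) : NumberField.RingOfIntegers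 K) ∉ v.asIdeal → ‖ι'.symm (ι β)‖ = 1 := by
  sorry

/-- STUB (XL, the OPEN bulk; PRINT on the potentially-automorphic sector, PROVED on members of full compatible families): FU at `n ≥ 3`. -/
theorem stub_higherRank : ∀ (K : Type) [Field K] [NumberField K] (n : ℕ), 0 < n → 3 ≤ n → ∀ (ℓ : ℕ) [Fact ℓ.Prime] (ι : PadicAlgCl ℓ ≃+* ℂ) (ρ : Literature.NumberTheory.GaloisRepresentations.FramedGaloisRep K (PadicAlgCl ℓ) n), ρ.toGaloisRep.IsIrreducible → ((∀ᶠ v : IsDedekindDomain.HeightOneSpectrum (NumberField.RingOfIntegers K) in cofinite, ρ.IsUnramifiedAt v) ∧ ∀ (v : IsDedekindDomain.HeightOneSpectrum (NumberField.RingOfIntegers K)) (hv : ((ℓ : ℕ) : NumberField.RingOfIntegers K) ∈ v.asIdeal), (Literature.NumberTheory.PAdicHodge.fontainePstAdicCompletion v ℓ hv).IsDeRhamFramed (ρ.toLocal v)) → ∀ᶠ v : IsDedekindDomain.HeightOneSpectrum (NumberField.RingOfIntegers K) in Filter.cofinite, ∀ P : Polynomial (PadicAlgCl ℓ), ρ.HasFrobCharpolyAt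 v P → ∀ β ∈ P.roots, ∀ (ℓ' : ℕ) [Fact ℓ'.Prime] (ι' : PadicAlgCl ℓ' ≃+* ℂ), ((ℓ' : ℕ) : NumberField.RingOfIntegers K) ∉ v.asIdeal → ‖ι'.symm (ι β)‖ = 1 := by
  sorry

/-- **the crux from the stubs** (kernel; writer-1 v2 skeleton shape L2052: the composition keeps its stub-statement hypotheses and concludes
the statement behind `id`, so that the ONE hypothesis-free `FrobeniusUnits_proof` below is the by-name skeleton theorem): cases `n = 1` / `n = 2` / `n ≥ 3`. -/
theorem FrobeniusUnits_of (h1 : ∀ (K : Type) [Field K] [NumberField K] (n : ℕ), 0 < n → n = 1 → ∀ (ℓ : ℕ) [Fact ℓ.Prime] (ι : PadicAlgCl ℓ ≃+* ℂ) (ρ : Literature.NumberTheory.GaloisRepresentations.FramedGaloisRep K (PadicAlgCl ℓ) n), ρ.toGaloisRep.IsIrreducible → ((∀ᶠ v : IsDedekindDomain.HeightOneSpectrum (NumberField.RingOfIntegers K) in cofinite, ρ.IsUnramifiedAt v) ∧ ∀ (v : IsDedekindDomain.HeightOneSpectrum (NumberField.RingOfIntegers K)) (hv : ((ℓ : ℕ)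 : NumberField.RingOfIntegers K) ∈ v.asIdeal), (Literature.NumberTheory.PAdicHodge.fontainePstAdicCompletion v ℓ hv).IsDeRhamFramed (ρ.toLocal v)) → ∀ᶠ v : IsDedekindDomain.HeightOneSpectrum (NumberField.RingOfIntegers K) in Filter.cofinite, ∀ P : Polynomial (PadicAlgCl ℓ), ρ.HasFrobCharpolyAt v P → ∀ β ∈ P.roots, ∀ (ℓ' : ℕ) [Fact ℓ'.Prime] (ι' : PadicAlgCl ℓ' ≃+* ℂ), ((ℓ' : ℕ) : NumberField.RingOfIntegers K) ∉ v.asIdeal → ‖ι'.symm (ι β)‖ = 1) (h2 : ∀ (K : Type) [Field K] [NumberField K] (n : ℕ), 0 < n → n = 2 → ∀ (ℓ : ℕ) [Fact ℓ.Prime] (ι : PadicAlgCl ℓ ≃+* ℂ) (ρ : Literature.NumberTheory.GaloisRepresentations.FramedGaloisRep K (PadicAlgCl ℓ) n), ρ.toGaloisRep.IsIrreducible → ((∀ᶠ v : IsDedekindDomain.HeightOneSpectrum (NumberField.RingOfIntegers K) in cofinite, ρ.IsUnramifiedAt v) ∧ ∀ (v : IsDedekindDomain.HeightOneSpectrum (NumberField.RingOfIntegers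 K)) (hv : ((ℓ : ℕ) : NumberField.RingOfIntegers K) ∈ v.asIdeal), (Literature.NumberTheory.PAdicHodge.fontainePstAdicCompletion v ℓ hv).IsDeRhamFramed (ρ.toLocal v)) → ∀ᶠ v : IsDedekindDomain.HeightOneSpectrum (NumberField.RingOfIntegers K) in Filter.cofinite, ∀ P : Polynomial (PadicAlgCl ℓ), ρ.HasFrobCharpolyAt v P → ∀ β ∈ P.roots, ∀ (ℓ' : ℕ) [Fact ℓ'.Prime] (ι' : PadicAlgCl ℓ' ≃+* ℂ), ((ℓ' : ℕ) : NumberField.RingOfIntegers K) ∉ v.asIdeal → ‖ι'.symm (ι β)‖ = 1) (h3 : ∀ (K : Type) [Field K] [NumberField K] (n : ℕ), 0 < n → 3 ≤ n → ∀ (ℓ : ℕ) [Fact ℓ.Prime] (ι : PadicAlgCl ℓ ≃+* ℂ) (ρ : Literature.NumberTheory.GaloisRepresentations.FramedGaloisRep K (PadicAlgCl ℓ) n), ρ.toGaloisRep.IsIrreducible → ((∀ᶠ v : IsDedekindDomain.HeightOneSpectrum (NumberField.RingOfIntegers K) in cofinite, ρ.IsUnramifiedAt v) ∧ ∀ (v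 : IsDedekindDomain.HeightOneSpectrum (NumberField.RingOfIntegers K)) (hv : ((ℓ : ℕ) : NumberField.RingOfIntegers K) ∈ v.asIdeal), (Literature.NumberTheory.PAdicHodge.fontainePstAdicCompletion v ℓ hv).IsDeRhamFramed (ρ.toLocal v)) → ∀ᶠ v : IsDedekindDomain.HeightOneSpectrum (NumberField.RingOfIntegers K) in Filter.cofinite, ∀ P : Polynomial (PadicAlgCl ℓ), ρ.HasFrobCharpolyAt v P → ∀ β ∈ P.roots, ∀ (ℓ' : ℕ) [Fact ℓ'.Prime] (ι' : PadicAlgCl ℓ' ≃+* ℂ), ((ℓ' : ℕ) : NumberField.RingOfIntegers K) ∉ v.asIdeal → ‖ι'.symm (ι β)‖ = 1) :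
    id FrobeniusUnits := by
  dsimp only [id]
  intro K _ _ n hn ℓ _ ι ρ hirr hgeo
  rcases (by omega : n = 1 ∨ n = 2 ∨ 3 ≤ n) with h | h | h
  · exact h1 K n hn h ℓ ι ρ hirr hgeo
  · exact h2 K n hn h ℓ ι ρ hirr hgeo
  · exact h3 K n hn h ℓ ι ρ hirr hgeo

/-- **the local crux copy BY NAME from the named stubs** (hypothesis-free; sorries only via the three `stub_*`). -/
theorem FrobeniusUnits_proof : FrobeniusUnits := FrobeniusUnits_of stub_rankOne stub_rankTwo stub_higherRank

/-- the stubs ARE restrictions of the crux. -/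
theorem rankOne_of_crux (h : FrobeniusUnits) : ∀ (K : Type) [Field K] [NumberField K] (n : ℕ), 0 < n → n = 1 → ∀ (ℓ : ℕ) [Fact ℓ.Prime] (ι : PadicAlgCl ℓ ≃+* ℂ) (ρ : Literature.NumberTheory.GaloisRepresentations.FramedGaloisRep K (PadicAlgCl ℓ) n), ρ.toGaloisRep.IsIrreducible → ((∀ᶠ v : IsDedekindDomain.HeightOneSpectrum (NumberField.RingOfIntegers K) in cofinite, ρ.IsUnramifiedAt v) ∧ ∀ (v : IsDedekindDomain.HeightOneSpectrum (NumberField.RingOfIntegers K)) (hv : ((ℓ : ℕ) : NumberField.RingOfIntegers K) ∈ v.asIdeal), (Literature.NumberTheory.PAdicHodge.fontainePstAdicCompletion v ℓ hv).IsDeRhamFramed (ρ.toLocal v)) → ∀ᶠ v : IsDedekindDomain.HeightOneSpectrum (NumberField.RingOfIntegers K) in Filter.cofinite, ∀ P : Polynomial (PadicAlgCl ℓ), ρ.HasFrobCharpolyAt v P → ∀ β ∈ P.roots, ∀ (ℓ' : ℕ) [Fact ℓ'.Prime] (ι' : PadicAlgCl ℓ' ≃+* ℂ), ((ℓ' : ℕ)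 : NumberField.RingOfIntegers K) ∉ v.asIdeal → ‖ι'.symm (ι β)‖ = 1 :=
  fun K _ _ n hn _ ℓ _ ι ρ hirr hgeo => h K n hn ℓ ι ρ hirr hgeo

theorem rankTwo_of_crux (h : FrobeniusUnits) : ∀ (K : Type) [Field K] [NumberField K] (n : ℕ), 0 < n → n = 2 → ∀ (ℓ : ℕ) [Fact ℓ.Prime] (ι : PadicAlgCl ℓ ≃+* ℂ) (ρ : Literature.NumberTheory.GaloisRepresentations.FramedGaloisRep K (PadicAlgCl ℓ) n), ρ.toGaloisRep.IsIrreducible → ((∀ᶠ v : IsDedekindDomain.HeightOneSpectrum (NumberField.RingOfIntegers K) in cofinite, ρ.IsUnramifiedAt v) ∧ ∀ (v : IsDedekindDomain.HeightOneSpectrum (NumberField.RingOfIntegers K)) (hv : ((ℓ : ℕ) : NumberField.RingOfIntegers K) ∈ v.asIdeal), (Literature.NumberTheory.PAdicHodge.fontainePstAdicCompletion v ℓ hv).IsDeRhamFramed (ρ.toLocal v)) → ∀ᶠ v : IsDedekindDomain.HeightOneSpectrum (NumberField.RingOfIntegers K) in Filter.cofinite, ∀ P : Polynomial (PadicAlgCl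 ℓ), ρ.HasFrobCharpolyAt v P → ∀ β ∈ P.roots, ∀ (ℓ' : ℕ) [Fact ℓ'.Prime] (ι' : PadicAlgCl ℓ' ≃+* ℂ), ((ℓ' : ℕ) : NumberField.RingOfIntegers K) ∉ v.asIdeal → ‖ι'.symm (ι β)‖ = 1 :=
  fun K _ _ n hn _ ℓ _ ι ρ hirr hgeo => h K n hn ℓ ι ρ hirr hgeo

theorem higherRank_of_crux (h : FrobeniusUnits) : ∀ (K : Type) [Field K] [NumberField K] (n : ℕ), 0 < n → 3 ≤ n → ∀ (ℓ : ℕ) [Fact ℓ.Prime] (ι : PadicAlgCl ℓ ≃+* ℂ) (ρ : Literature.NumberTheory.GaloisRepresentations.FramedGaloisRep K (PadicAlgCl ℓ) n), ρ.toGaloisRep.IsIrreducible → ((∀ᶠ v : IsDedekindDomain.HeightOneSpectrum (NumberField.RingOfIntegers K) in cofinite, ρ.IsUnramifiedAt v) ∧ ∀ (v : IsDedekindDomain.HeightOneSpectrum (NumberField.RingOfIntegers K)) (hv : ((ℓ : ℕ) : NumberField.RingOfIntegers K) ∈ v.asIdeal), (Literature.NumberTheory.PAdicHodge.fontainePstAdicCompletion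 v ℓ hv).IsDeRhamFramed (ρ.toLocal v)) → ∀ᶠ v : IsDedekindDomain.HeightOneSpectrum (NumberField.RingOfIntegers K) in Filter.cofinite, ∀ P : Polynomial (PadicAlgCl ℓ), ρ.HasFrobCharpolyAt v P → ∀ β ∈ P.roots, ∀ (ℓ' : ℕ) [Fact ℓ'.Prime] (ι' : PadicAlgCl ℓ' ≃+* ℂ), ((ℓ' : ℕ) : NumberField.RingOfIntegers K) ∉ v.asIdeal → ‖ι'.symm (ι β)‖ = 1 :=
  fun K _ _ n hn _ ℓ _ ι ρ hirr hgeo => h K n hn ℓ ι ρ hirr hgeo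

/-- the BC5 rungs (PROVED; pure Galois-side algebra + the compact-image unit lemma). -/
theorem finiteOrderRung : FiniteOrderUnitRung :=
  fun K _ _ n hn ℓ _ ι ρ _ hfin _ => by
    obtain ⟨k, hk, hρ⟩ := hfin
    exact hasUnitFrobenius_of_finiteOrder ι ρ hk hρ

theorem compatibleFamilyRung : CompatibleFamilyUnitRung :=
  fun K _ _ n hn ℓ _ ι ρ _ hfam _ => by
    obtain ⟨S, hS, hfam⟩ := hfam
    exact hasUnitFrobenius_of_compatibleFamily ι ρ hS fun ℓ' _ ι' => hfam ℓ' ι'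

end Skeleton

/-- identity with the born route decl (same text; elaborates only AFTER birth). [folklore] -/
theorem FrobeniusUnits_iff_route : FrobeniusUnits ↔ Summit.Langlands.Langlands.Theses.FrobeniusUnitCarving.FrobeniusUnits := Iff.rfl

/-- writer-1 v2 shape on the ROUTE decl: the composition with NAMED hypotheses, conclusion behind `id`. [folklore] -/
theorem route_FrobeniusUnits_of (h1 : ∀ (K : Type) [Field K] [NumberField K] (n : ℕ), 0 < n → n = 1 → ∀ (ℓ : ℕ) [Fact ℓ.Prime] (ι : PadicAlgCl ℓ ≃+* ℂ) (ρ : Literature.NumberTheory.GaloisRepresentations.FramedGaloisRep K (PadicAlgCl ℓ) n), ρ.toGaloisRep.IsIrreducible → ((∀ᶠ v : IsDedekindDomain.HeightOneSpectrum (NumberField.RingOfIntegers K) in cofinite, ρ.IsUnramifiedAt v) ∧ ∀ (v : IsDedekindDomain.HeightOneSpectrum (NumberField.RingOfIntegers K)) (hv : ((ℓ : ℕ) : NumberField.RingOfIntegers K) ∈ v.asIdeal), (Literature.NumberTheory.PAdicHodge.fontainePstAdicCompletion v ℓ hv).IsDeRhamFramed (ρ.toLocal v)) → ∀ᶠ v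 : IsDedekindDomain.HeightOneSpectrum (NumberField.RingOfIntegers K) in Filter.cofinite, ∀ P : Polynomial (PadicAlgCl ℓ), ρ.HasFrobCharpolyAt v P → ∀ β ∈ P.roots, ∀ (ℓ' : ℕ) [Fact ℓ'.Prime] (ι' : PadicAlgCl ℓ' ≃+* ℂ), ((ℓ' : ℕ) : NumberField.RingOfIntegers K) ∉ v.asIdeal → ‖ι'.symm (ι β)‖ = 1) (h2 : ∀ (K : Type) [Field K] [NumberField K] (n : ℕ), 0 < n → n = 2 → ∀ (ℓ : ℕ) [Fact ℓ.Prime] (ι : PadicAlgCl ℓ ≃+* ℂ) (ρ : Literature.NumberTheory.GaloisRepresentations.FramedGaloisRep K (PadicAlgCl ℓ) n), ρ.toGaloisRep.IsIrreducible → ((∀ᶠ v : IsDedekindDomain.HeightOneSpectrum (NumberField.RingOfIntegers K) in cofinite, ρ.IsUnramifiedAt v) ∧ ∀ (v : IsDedekindDomain.HeightOneSpectrum (NumberField.RingOfIntegers K)) (hv : ((ℓ : ℕ) : NumberField.RingOfIntegers K) ∈ v.asIdeal), (Literature.NumberTheory.PAdicHodge.fontainePstAdicCompletion v ℓ hv).IsDeRhamFramed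 (ρ.toLocal v)) → ∀ᶠ v : IsDedekindDomain.HeightOneSpectrum (NumberField.RingOfIntegers K) in Filter.cofinite, ∀ P : Polynomial (PadicAlgCl ℓ), ρ.HasFrobCharpolyAt v P → ∀ β ∈ P.roots, ∀ (ℓ' : ℕ) [Fact ℓ'.Prime] (ι' : PadicAlgCl ℓ' ≃+* ℂ), ((ℓ' : ℕ) : NumberField.RingOfIntegers K) ∉ v.asIdeal → ‖ι'.symm (ι β)‖ = 1) (h3 : ∀ (K : Type) [Field K] [NumberField K] (n : ℕ), 0 < n → 3 ≤ n → ∀ (ℓ : ℕ) [Fact ℓ.Prime] (ι : PadicAlgCl ℓ ≃+* ℂ) (ρ : Literature.NumberTheory.GaloisRepresentations.FramedGaloisRep K (PadicAlgCl ℓ) n), ρ.toGaloisRep.IsIrreducible → ((∀ᶠ v : IsDedekindDomain.HeightOneSpectrum (NumberField.RingOfIntegers K) in cofinite, ρ.IsUnramifiedAt v) ∧ ∀ (v : IsDedekindDomain.HeightOneSpectrum (NumberField.RingOfIntegers K)) (hv : ((ℓ : ℕ) : NumberField.RingOfIntegers K) ∈ v.asIdeal), (Literature.NumberTheory.PAdicHodge.fontainePstAdicCompletion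 v ℓ hv).IsDeRhamFramed (ρ.toLocal v)) → ∀ᶠ v : IsDedekindDomain.HeightOneSpectrum (NumberField.RingOfIntegers K) in Filter.cofinite, ∀ P : Polynomial (PadicAlgCl ℓ), ρ.HasFrobCharpolyAt v P → ∀ β ∈ P.roots, ∀ (ℓ' : ℕ) [Fact ℓ'.Prime] (ι' : PadicAlgCl ℓ' ≃+* ℂ), ((ℓ' : ℕ) : NumberField.RingOfIntegers K) ∉ v.asIdeal → ‖ι'.symm (ι β)‖ = 1) :
    id Summit.Langlands.Langlands.Theses.FrobeniusUnitCarving.FrobeniusUnits := FrobeniusUnits_of h1 h2 h3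

/-- the ONE hypothesis-free theorem concluding the ROUTE decl BY NAME from the stubs (what `ledger skeleton check --crux` records). [folklore] -/
theorem route_FrobeniusUnits_proof : Summit.Langlands.Langlands.Theses.FrobeniusUnitCarving.FrobeniusUnits := route_FrobeniusUnits_of stub_rankOne stub_rankTwo stub_higherRank

end Summit.Langlands.Langlands.Theses.FrobeniusUnitCarving.Birth.FrobeniusUnits
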